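import Summits.CriticalPhenomena.PercolationContinuityZ3.Theorems.PercNearOneGluingNoHeavyQuantIndepBlobOneLightCorner
import Summits.CriticalPhenomena.PercolationContinuityZ3.Theorems.PercNearOneGluingNoHeavyQuantIndepBlobTwoLevelRow
import HarnessLib

/-!
# QUANT lane R8, the corner of Conjecture DIB\* with EXACTLY ONE light blob, in the typed (single index type) vocabulary of
# `Quant.IndepBlob.DIBStarCorner`

builds on p205010 (kernel theorem, internal audit signed; external expert review pending)

Support file (`--supports stmt-CriticalPhenomena-4575`), QUANT lane census seat prim-quant-census-1 (gen 14).  Bridge from the two-sorted form of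
`IndepBlob.tail_ge_of_oneLight_corner` (`…QuantIndepBlobOneLightCorner.lean`: heavy blobs on `ι`, the light blob as a separate pair `(b, g)`) to the
one-sorted form of typer g17's `Quant.IndepBlob.DIBStarCorner` (`…QuantDIBStarCorner.lean`: all blobs on one type `κ`, heavy = `x ≤ g k`), by splitting the
light blob off with `IndepBlob.tail_split` (`…QuantIndepBlobTwoLevelRow.lean`).

* `IndepBlob.dibCorner_of_oneLight` — floor `1/2 ≤ x < 1`; blobs `k : κ` with sizes `a k ∈ ℕ`, gates `g k ∈ [0,1]`; ONE blob `ℓ` is light (`g ℓ < x`, `a ℓ ≤ j`),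
  every other blob is heavy (`x ≤ g k`); corner `Σ_{k ≠ ℓ} a k ≤ 2j`; credit `2j < Σ_{k ≠ ℓ} a k·g k + a ℓ·(g ℓ − x²)/(1 − x)`
  ⟹ `x ≤ Σ_W wt(W)·𝟙[j+1 ≤ Σ_{k∈W} a k]`.  (If `g ℓ < x²` the light credit is negative, the heavy budget alone exceeds `2j`, and `far_indepBlob` on the
  heavy blobs suffices since adding a blob never lowers the tail.)  This is `DIBStarCorner x` restricted to instances with exactly one light blob; the
  general corner (several light blobs) stays open.
[cite: KozmaNitzan2024, Conjecture 3 (p. 15)] (the gluing rows served); [this work].  Theorems only, no sorries, standard axioms.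
-/

namespace Summit.CriticalPhenomena.PercolationContinuityZ3.Theorems

namespace Quant

namespace IndepBlob

open Finset

variable {κ : Type*} [Fintype κ] [DecidableEq κ]

/-- **The DIB\* corner with exactly one light blob (one-sorted form).**  See the module docstring. [this work] -/
theorem dibCorner_of_oneLight (x : ℝ) (hxhalf : 1 / 2 ≤ x) (hx1 : x < 1) (a : κ → ℕ) (g : κ → ℝ) (j : ℕ)
    (hg : ∀ k, 0 ≤ g k ∧ g k ≤ 1) (ℓ : κ) (hℓ : g ℓ < x) (haℓ : a ℓ ≤ j) (hheavy : ∀ k, k ≠ ℓ → x ≤ g k)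
    (hcorner : (∑ k ∈ (Finset.univ : Finset κ).erase ℓ, (a k : ℝ)) ≤ 2 * j)
    (hcredit : (2 * j : ℝ) < (∑ k ∈ (Finset.univ : Finset κ).erase ℓ, (a k : ℝ) * g k) + a ℓ * ((g ℓ - x ^ 2) / (1 - x))) :
    x ≤ ∑ W : Finset κ, (∏ k, if k ∈ W then g k else 1 - g k) * (if j + 1 ≤ ∑ k ∈ W, a k then (1 : ℝ) else 0) := by
  have hx0 : 0 < x := by linarith
  -- filter form and the split at `ℓ`
  have hform : ∑ W : Finset κ, (∏ k, if k ∈ W then g k else 1 - g k) * (if j + 1 ≤ ∑ k ∈ W, a k then (1 : ℝ) else 0) =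
      ∑ W ∈ (Finset.univ : Finset (Finset κ)).filter (fun s => j + 1 ≤ ∑ k ∈ s, a k), (∏ k, if k ∈ W then g k else 1 - g k) := by
    rw [Finset.sum_filter]
    exact Finset.sum_congr rfl fun W _ => by split_ifs <;> simp
  rw [hform, tail_split g a ℓ (j + 1)]
  set ι := {k : κ // k ≠ ℓ} with hι
  -- data on the subtype
  have hsub : ∀ f : κ → ℝ, ∑ k ∈ (Finset.univ : Finset κ).erase ℓ, f k = ∑ i : ι, f (i : κ) := by
    intro f
    exact Finset.sum_subtype _ (fun k => by simp [Finset.mem_erase]) f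
  have hp : ∀ i : ι, x ≤ g (i : κ) := fun i => hheavy i i.2
  have hp1 : ∀ i : ι, g (i : κ) ≤ 1 := fun i => (hg i).2
  have hp0 : ∀ i : ι, 0 ≤ g (i : κ) := fun i => (hg i).1
  have hw0 : ∀ W : Finset ι, 0 ≤ (∏ i : ι, if i ∈ W then g (i : κ) else 1 - g (i : κ)) := bernoulliWeight_nonneg hp0 hp1
  have hcorner' : (∑ i : ι, ((a (i : κ) : ℕ) : ℝ)) ≤ 2 * j := by rw [← hsub (fun k => (a k : ℝ))]; exact hcorner
  have hcredit' : (2 * j : ℝ) < (∑ i : ι, ((a (i : κ) : ℕ) : ℝ) * g (i : κ)) + a ℓ * ((g ℓ - x ^ 2) / (1 - x)) := by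
    rw [← hsub (fun k => (a k : ℝ) * g k)]; exact hcredit
  -- the two conditional tails over the heavy blobs
  set A : ℝ := ∑ W ∈ (Finset.univ : Finset (Finset ι)).filter (fun W : Finset ι => j + 1 ≤ a ℓ + ∑ i ∈ W, a (i : κ)),
      (∏ i : ι, if i ∈ W then g (i : κ) else 1 - g (i : κ)) with hA
  set U : ℝ := ∑ W ∈ (Finset.univ : Finset (Finset ι)).filter (fun W : Finset ι => j + 1 ≤ ∑ i ∈ W, a (i : κ)),
      (∏ i : ι, if i ∈ W then g (i : κ) else 1 - g (i : κ)) with hU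
  show x ≤ g ℓ * A + (1 - g ℓ) * U
  by_cases hgx2 : x ^ 2 ≤ g ℓ
  · -- the corner row in two-sorted form
    have h := tail_ge_of_oneLight_corner (fun i : ι => g (i : κ)) (fun i : ι => a (i : κ)) x (g ℓ) (a ℓ) j hx0 hxhalf hx1
      hp hp1 hgx2 hℓ.le haℓ hcorner' hcredit'
    have e : ∑ W : Finset ι, (∏ i : ι, if i ∈ W then g (i : κ) else 1 - g (i : κ)) *
        (g ℓ * (if j + 1 ≤ ∑ i ∈ W, a (i : κ) + a ℓ then (1 : ℝ) else 0) + (1 - g ℓ) * (if j + 1 ≤ ∑ i ∈ W, a (i : κ) then (1 : ℝ) else 0)) =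
        g ℓ * A + (1 - g ℓ) * U := by
      rw [hA, hU, Finset.sum_filter, Finset.sum_filter, Finset.mul_sum, Finset.mul_sum, ← Finset.sum_add_distrib]
      refine Finset.sum_congr rfl fun W _ => ?_
      rw [add_comm (∑ i ∈ W, a (i : κ)) (a ℓ)]
      split_ifs <;> ring
    rw [e] at h; exact h
  · -- negative light credit: the heavy blobs alone have budget `> 2j`
    push Not at hgx2
    have hneg : (a ℓ : ℝ) * ((g ℓ - x ^ 2) / (1 - x)) ≤ 0 :=
      mul_nonpos_of_nonneg_of_nonpos (Nat.cast_nonneg _) (div_nonpos_of_nonpos_of_nonneg (by linarith) (by linarith))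
    have hbudget : (2 * j : ℝ) < 0 * x + ∑ i : ι, ((a (i : κ) : ℕ) : ℝ) * g (i : κ) := by linarith
    have hfar := far_indepBlob (fun i : ι => g (i : κ)) (fun i : ι => ((a (i : κ) : ℕ) : ℝ)) x 0 hx0.le hx1.le hp hp1
      (fun i => Nat.cast_nonneg _) le_rfl (j : ℝ) hbudget
    simp only [add_zero] at hfar
    have hPle : ∑ W ∈ (Finset.univ : Finset (Finset ι)).filter (fun W : Finset ι => ∑ i ∈ W, ((a (i : κ) : ℕ) : ℝ) ≤ j),
        (∏ i : ι, if i ∈ W then g (i : κ) else 1 - g (i : κ)) ≤ 1 - x := by nlinarith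
    have htot := Finset.sum_filter_add_sum_filter_not (Finset.univ : Finset (Finset ι)) (fun W : Finset ι => ∑ i ∈ W, ((a (i : κ) : ℕ) : ℝ) ≤ j)
      (fun W : Finset ι => ∏ i : ι, if i ∈ W then g (i : κ) else 1 - g (i : κ))
    rw [sum_bernoulliWeight] at htot
    have hUeq : U = ∑ W ∈ (Finset.univ : Finset (Finset ι)).filter (fun W : Finset ι => ¬ (∑ i ∈ W, ((a (i : κ) : ℕ) : ℝ) ≤ j)),
        (∏ i : ι, if i ∈ W then g (i : κ) else 1 - g (i : κ)) := by
      rw [hU]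
      refine Finset.sum_congr ?_ fun _ _ => rfl
      ext W
      simp only [Finset.mem_filter, Finset.mem_univ, true_and]
      rw [← Nat.cast_sum, Nat.cast_le, not_le, Nat.lt_iff_add_one_le]
    have hUx : x ≤ U := by rw [hUeq]; linarith
    have hUA : U ≤ A := by
      rw [hU, hA]
      refine Finset.sum_le_sum_of_subset_of_nonneg (fun W hW => ?_) fun W _ _ => hw0 W
      rw [Finset.mem_filter] at hW ⊢
      exact ⟨hW.1, le_trans hW.2 (Nat.le_add_left _ _)⟩
    nlinarith [(hg ℓ).1, (hg ℓ).2]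

end IndepBlob

end Quant

end Summit.CriticalPhenomena.PercolationContinuityZ3.Theorems
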